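import Summits.Ventures.LatticeQCDFlow.Scaling.SpecificHeatFloorLog2Law
import Summits.Ventures.LatticeQCDFlow.Scaling.ExtensiveSpecificHeat
import Summits.Ventures.LatticeQCDFlow.Scaling.WilsonSpecificHeatFloor
import HarnessLib

/-!
HONEST FRAMING: exact (Metropolis-corrected) sampling algorithms for lattice gauge theory;
figures of merit are autocorrelation/cost numbers at stated couplings and volumes; no
continuum-physics claim.

# HaarStartProtocolLawShift — THE SHIFTED `log²` LAWS: `protocolCost` IS TRANSLATION-INVARIANT, AND AN
# ALL-COUPLING FLOOR `K/(1+u²)` GIVES THE LAYER / WINDOW LAWS FROM ANY START `b_0 ≥ 0`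
# (theory2 item 129, PART 1 of 2: §1–§2)

CUSTODY: theory2 item 129 (GEN-42, HOME tier) re-landed by lean-2 GEN-10 per LEAD LINE 257 RT-30 (210)(d)
(the packet's FIFTH member after 125 → 126 → 127 → 128); statements and proofs =
HOME/lean/theory2/HaarStartProtocolLaw.lean 6e9239f81cd059d4 (504 l) verbatim, split below the `lint.size`
line into TWO files (`HaarStartProtocolLawShift` §1–§2, `HaarStartProtocolLaw` §3–§4, the second importing
the first); headers trimmed (PART 2 keeps the full HOME header); imports = HOME's (all tree modules:
items 125 / 126 / 128 as landed); landing edits: one docstring added where the lint asks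
(`card_plaquette_pos`), and — named by the gate's `near-duplicate` screen at dry-run — HOME's two elementary
lemmas `one_add_sq_le_sq_one_add` (`1 + u² ≤ (1+u)²`, ≡ `Literature.NumberTheory.Sieve.RegimeB.one_add_sq_le_sq`)
and `sq_one_add_le_two_mul` (unused) DROPPED, the single use in `floor_shift_of_floor` inlined as
`by nlinarith [hu]`; no other declaration changes (builder `build129.py` in the custodian's seat folder).

THEORY-2 item 129 (theory2 GEN-42; cell pub-lqcd / Ventures/LatticeQCDFlow).  Main theorem of the
series (`wilson_variance_floor_allCouplings`, PART 2): `∃ c = c(n,d) > 0, ∀ L ≥ 2, ∀ u ≥ 0,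
c·#plaq/(1+u²) ≤ Var_{π_u}(S_W)` (pure `SU(n)`, `n ≥ 2`, `d ≥ 2`) and item 125's three Wilson layer
laws from ANY start `b_0 ≥ 0` — the Haar prior `b_0 = 0` included — with `log(b_m/b_0)` replaced by
`log((1+b_m)/(1+b_0))`.  This part: §1 (abstract) `protocolCost_shift` (translating free energy and
protocol by the same `a` changes nothing), `convexOn_shift_add_mul_log_of_floor` (a floor `K/(1+u)²`
on `[0,∞)` is convexity of `v ↦ ψ(v−1) + K log v` on `[1,∞)`), and item 125's three laws with
`log((1+b_n)/(1+b_0))` (`protocolCost_ge_sq_div_shift`, `layers_necessary_shift`,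
`logRatio_le_of_stepCost_shift`); §2 (lattice, smooth action `S` on `SU(N)^E`) under the ALL-COUPLING
FLOOR `∀ u ≥ 0, K/(1+u²) ≤ Var_u(S)`: `specificHeatFloor_of_allCouplingFloor` (item 125's (SH) on every
`[β₀,∞)` with `K·β₀²/(1+β₀²)`), `protocolLaw_of_allCouplingFloor`, `layers_necessary_of_allCouplingFloor`,
`logRatio_le_of_stepCost_of_allCouplingFloor`.
-/

noncomputable section

open Finset Set Real

namespace Summit.Ventures.LatticeQCDFlow.Theory2.HaarStart

open Summit.Ventures.LatticeQCDFlow.Theory2.SpecificHeat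

/-! ## §1. The shift: `protocolCost` is translation-invariant; a floor `K/(1+u)²` on `[0,∞)` is
convexity of `ψ(· − 1) + K log` on `[1,∞)`; item 125's laws with `log((1+b_m)/(1+b_0))` -/

section Shift

variable {n : ℕ}

/-- **Shift invariance of the protocol cost**: translating the free energy and the protocol by the
same `a` changes nothing (`2(a + y) − (a + x) − a = 2y − x`). [ours] -/
theorem protocolCost_shift (F : ℝ → ℝ) (a : ℝ) (b : Fin (n + 1) → ℝ) :
    protocolCost (fun v => F (v - a)) (fun j => a + b j) = protocolCost F b := by
  simp only [protocolCost, add_sub_cancel_left]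
  refine Finset.sum_congr rfl fun j _ => ?_
  rw [show 2 * (a + b j.succ) - (a + b j.castSucc) - a = 2 * b j.succ - b j.castSucc by ring]

/-- **`K/(1+u)² ≤ ψ″(u)` for `u ≥ 0` ⟹ `v ↦ ψ(v − 1) + K log v` is convex on `[1, ∞)`**
(item 125's calculus bridge at `β₀ = 1`, precomposed with the translation `v ↦ v − 1`). [ours] -/
theorem convexOn_shift_add_mul_log_of_floor {ψ ψ' V : ℝ → ℝ} {K : ℝ}
    (hψ : ∀ t, HasDerivAt ψ (ψ' t) t) (hψ' : ∀ t, HasDerivAt ψ' (V t) t)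
    (hfloor : ∀ u, 0 ≤ u → K / (1 + u) ^ 2 ≤ V u) :
    ConvexOn ℝ (Ici 1) (fun v => ψ (v - 1) + K * Real.log v) :=
  convexOn_add_mul_log_of_floor (ψ := fun v => ψ (v - 1)) (ψ' := fun v => ψ' (v - 1))
    (V := fun v => V (v - 1)) one_pos (fun t => (hψ (t - 1)).comp_sub_const t 1)
    (fun t => (hψ' (t - 1)).comp_sub_const t 1) fun t ht => by
      have h := hfloor (t - 1) (by linarith)
      rwa [show (1 : ℝ) + (t - 1) = t by ring] at h

/-- **THE SHIFTED `log²` NECESSITY LAW (abstract).**  If `v ↦ F(v − 1) + K log v` is convex on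
`[1, ∞)` (`K ≥ 0`) then for EVERY monotone protocol `0 ≤ b_0 ≤ … ≤ b_n` (`n ≥ 1`),
with `U = log((1 + b_n)/(1 + b_0))`: **`K·U²/(n + U) ≤ protocolCost F b`**. [ours] -/
theorem protocolCost_ge_sq_div_shift {F : ℝ → ℝ} {K : ℝ} (hK : 0 ≤ K)
    (hG : ConvexOn ℝ (Ici 1) (fun v => F (v - 1) + K * Real.log v)) (hn : 0 < n)
    (b : Fin (n + 1) → ℝ) (hb0 : 0 ≤ b 0) (hb : Monotone b) :
    K * (Real.log ((1 + b (Fin.last n)) / (1 + b 0))) ^ 2 /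
        (n + Real.log ((1 + b (Fin.last n)) / (1 + b 0))) ≤ protocolCost F b := by
  have h := protocolCost_ge_sq_div (F := fun v => F (v - 1)) one_pos hK hG hn (fun j => 1 + b j)
    (show (1 : ℝ) ≤ 1 + b 0 by linarith)
    (fun i j hij => show 1 + b i ≤ 1 + b j by linarith [hb hij])
  rwa [protocolCost_shift] at h

/-- **SHIFTED LAYERS NECESSARY**: cost `≤ t` (`t > 0`) forces
**`n ≥ K·log²((1+b_n)/(1+b_0))/t − log((1+b_n)/(1+b_0))`**. [ours] -/
theorem layers_necessary_shift {F : ℝ → ℝ} {K t : ℝ} (hK : 0 ≤ K)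
    (hG : ConvexOn ℝ (Ici 1) (fun v => F (v - 1) + K * Real.log v)) (hn : 0 < n)
    (b : Fin (n + 1) → ℝ) (hb0 : 0 ≤ b 0) (hb : Monotone b) (ht : 0 < t)
    (hcost : protocolCost F b ≤ t) :
    K * (Real.log ((1 + b (Fin.last n)) / (1 + b 0))) ^ 2 / t -
        Real.log ((1 + b (Fin.last n)) / (1 + b 0)) ≤ n := by
  rw [← protocolCost_shift F 1 b] at hcost
  exact layers_necessary (F := fun v => F (v - 1)) one_pos hK hG hn (fun j => 1 + b j)
    (show (1 : ℝ) ≤ 1 + b 0 by linarith)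
    (fun i j hij => show 1 + b i ≤ 1 + b j by linarith [hb hij]) ht hcost

/-- **SHIFTED PER-STEP WINDOW LAW**: if every step costs `≤ t₀` (`t₀ ≥ 0`, `K > 0`) then
**`log((1+b_n)/(1+b_0)) ≤ n·(t₀/K + √(t₀/K))`**. [ours] -/
theorem logRatio_le_of_stepCost_shift {F : ℝ → ℝ} {K t₀ : ℝ} (hK : 0 < K)
    (hG : ConvexOn ℝ (Ici 1) (fun v => F (v - 1) + K * Real.log v)) (b : Fin (n + 1) → ℝ)
    (hb0 : 0 ≤ b 0) (hb : Monotone b) (ht : 0 ≤ t₀)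
    (hstep : ∀ j : Fin n,
      F (b j.castSucc) + F (2 * b j.succ - b j.castSucc) - 2 * F (b j.succ) ≤ t₀) :
    Real.log ((1 + b (Fin.last n)) / (1 + b 0)) ≤ n * (t₀ / K + Real.sqrt (t₀ / K)) := by
  refine logRatio_le_of_stepCost (F := fun v => F (v - 1)) one_pos hK hG (fun j => 1 + b j)
    (show (1 : ℝ) ≤ 1 + b 0 by linarith)
    (fun i j hij => show 1 + b i ≤ 1 + b j by linarith [hb hij]) ht fun j => ?_
  have e : 2 * (1 + b j.succ) - (1 + b j.castSucc) - 1 = 2 * b j.succ - b j.castSucc := by ring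
  show F (1 + b j.castSucc - 1) + F (2 * (1 + b j.succ) - (1 + b j.castSucc) - 1) -
      2 * F (1 + b j.succ - 1) ≤ t₀
  rw [add_sub_cancel_left, add_sub_cancel_left, e]
  exact hstep j

end Shift

/-! ## §2. Lattice gauge theory: the all-coupling floor and the laws from any start `b_0 ≥ 0` -/

section LatticeGauge

open MeasureTheory ProbabilityTheory
open Literature.MathematicalPhysics.QuantumFieldTheory
open Literature.MathematicalPhysics.QuantumFieldTheory.Luscher2010
open Literature.MathematicalPhysics.QuantumFieldTheory.WilsonFlow (coeConfig)
open Summit.Ventures.LatticeQCDFlow.TrivializingMaps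
open scoped ContDiff Matrix Matrix.Norms.Frobenius

variable {d L N : ℕ} [NeZero L] {S : AmbConfig d L N → ℝ} {n : ℕ}

/-- An all-coupling floor `K/(1+u²)` (`K ≥ 0`) gives the shifted floor `K/(1+u)²`. [ours] -/
theorem floor_shift_of_floor {K : ℝ} (hK : 0 ≤ K)
    (hAF : ∀ u : ℝ, 0 ≤ u → K / (1 + u ^ 2) ≤ actionVar S u) (u : ℝ) (hu : 0 ≤ u) :
    K / (1 + u) ^ 2 ≤ actionVar S u :=
  (div_le_div_of_nonneg_left hK (by positivity) (by nlinarith [hu])).trans (hAF u hu)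

/-- **The all-coupling floor implies item 125's (SH) on every `[β₀, ∞)`, `β₀ > 0`**, with
constant `K·β₀²/(1+β₀²)`: `AllCouplingFloor ⟹ SpecificHeatFloor S β₀ (K β₀²/(1+β₀²))`. [ours] -/
theorem specificHeatFloor_of_allCouplingFloor {K β₀ : ℝ} (hK : 0 ≤ K) (hβ₀ : 0 < β₀)
    (hAF : ∀ u : ℝ, 0 ≤ u → K / (1 + u ^ 2) ≤ actionVar S u) :
    SpecificHeatFloor S β₀ (K * β₀ ^ 2 / (1 + β₀ ^ 2)) := by
  intro u hu
  have hu0 : 0 < u := lt_of_lt_of_le hβ₀ hu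
  refine le_trans ?_ (hAF u hu0.le)
  rw [div_div, div_le_div_iff₀ (mul_pos (by positivity) (pow_pos hu0 2)) (by positivity)]
  have h1 : β₀ ^ 2 ≤ u ^ 2 := pow_le_pow_left₀ hβ₀.le hu 2
  nlinarith [mul_nonneg hK (sub_nonneg.2 h1)]

/-- (AF) ⟹ `v ↦ ψ_S(v − 1) + K log v` convex on `[1, ∞)` (`ψ_S″ = Var`, tree). [ours] -/
theorem convexOn_actionCGF_shift_of_allCouplingFloor (hS : ContDiff ℝ ∞ S)
    {K : ℝ} (hK : 0 ≤ K)
    (hAF : ∀ u : ℝ, 0 ≤ u → K / (1 + u ^ 2) ≤ actionVar S u) :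
    ConvexOn ℝ (Ici 1) (fun v => actionCGF S (v - 1) + K * Real.log v) :=
  convexOn_shift_add_mul_log_of_floor (fun t => hasDerivAt_cgf_neg_action hS t)
    (fun t => hasDerivAt_deriv_cgf hS t) (floor_shift_of_floor hK hAF)

/-- **LATTICE `log²` LAYER LAW FROM ANY START.**  For a smooth action `S` on `SU(N)^E` with the
all-coupling floor `∀ u ≥ 0, K/(1+u²) ≤ Var_u(S)` (`K ≥ 0`), EVERY monotone protocol
`0 ≤ b_0 ≤ … ≤ b_n` (`n ≥ 1`) of exact reweighting steps obeys
**`K·log²((1+b_n)/(1+b_0))/(n + log((1+b_n)/(1+b_0))) ≤ Σ_j log E_{μ_{b_j}}[w_j²]`**.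
[ours] -/
theorem protocolLaw_of_allCouplingFloor (hS : ContDiff ℝ ∞ S) {K : ℝ} (hK : 0 ≤ K)
    (hAF : ∀ u : ℝ, 0 ≤ u → K / (1 + u ^ 2) ≤ actionVar S u) (hn : 0 < n)
    (b : Fin (n + 1) → ℝ)
    (hb0 : 0 ≤ b 0) (hb : Monotone b) :
    K * (Real.log ((1 + b (Fin.last n)) / (1 + b 0))) ^ 2 /
        (n + Real.log ((1 + b (Fin.last n)) / (1 + b 0))) ≤
      ∑ j : Fin n, Real.log (weightSqMoment S (b j.castSucc) (b j.succ - b j.castSucc)) := by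
  rw [sum_log_weightSqMoment_eq_protocolCost hS]
  exact protocolCost_ge_sq_div_shift hK (convexOn_actionCGF_shift_of_allCouplingFloor hS hK hAF)
    hn b hb0 hb

/-- **LAYERS NECESSARY FROM ANY START (lattice)**: `Σ_j log E[w_j²] ≤ t` forces
**`n ≥ K·log²((1+b_n)/(1+b_0))/t − log((1+b_n)/(1+b_0))`**. [ours] -/
theorem layers_necessary_of_allCouplingFloor (hS : ContDiff ℝ ∞ S) {K t : ℝ} (hK : 0 ≤ K)
    (hAF : ∀ u : ℝ, 0 ≤ u → K / (1 + u ^ 2) ≤ actionVar S u) (hn : 0 < n)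
    (b : Fin (n + 1) → ℝ)
    (hb0 : 0 ≤ b 0) (hb : Monotone b) (ht : 0 < t)
    (hcost :
      ∑ j : Fin n, Real.log (weightSqMoment S (b j.castSucc) (b j.succ - b j.castSucc)) ≤ t) :
    K * (Real.log ((1 + b (Fin.last n)) / (1 + b 0))) ^ 2 / t -
        Real.log ((1 + b (Fin.last n)) / (1 + b 0)) ≤ n := by
  rw [sum_log_weightSqMoment_eq_protocolCost hS] at hcost
  exact layers_necessary_shift hK (convexOn_actionCGF_shift_of_allCouplingFloor hS hK hAF) hn b hb0
    hb ht hcost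

/-- **PER-STEP WINDOW LAW FROM ANY START (lattice)**: if every exact reweighting step has
`log E[w_j²] ≤ t₀` then **`log((1+b_n)/(1+b_0)) ≤ n·(t₀/K + √(t₀/K))`** (`K > 0`).
[ours] -/
theorem logRatio_le_of_stepCost_of_allCouplingFloor (hS : ContDiff ℝ ∞ S) {K t₀ : ℝ}
    (hK : 0 < K)
    (hAF : ∀ u : ℝ, 0 ≤ u → K / (1 + u ^ 2) ≤ actionVar S u) (b : Fin (n + 1) → ℝ)
    (hb0 : 0 ≤ b 0) (hb : Monotone b) (ht : 0 ≤ t₀)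
    (hstep : ∀ j : Fin n,
      Real.log (weightSqMoment S (b j.castSucc) (b j.succ - b j.castSucc)) ≤ t₀) :
    Real.log ((1 + b (Fin.last n)) / (1 + b 0)) ≤ n * (t₀ / K + Real.sqrt (t₀ / K)) := by
  refine logRatio_le_of_stepCost_shift hK
    (convexOn_actionCGF_shift_of_allCouplingFloor hS hK.le hAF) b hb0 hb ht fun j => ?_
  have h := hstep j
  rw [log_weightSqMoment hS, add_sub_cancel, show b j.castSucc + 2 * (b j.succ - b j.castSucc) =
    2 * b j.succ - b j.castSucc by ring] at h
  exact h

end LatticeGauge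

end Summit.Ventures.LatticeQCDFlow.Theory2.HaarStart

end
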